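import Mathlib
import Summits.Ventures.DiscreteObjects.Mahler.CyclotomicIntegerTwoAdic

/-!
# `2^{φ(m)} ≤ (∏_μ max(1,|g(μ)|))^6` for every conductor: the 2-adic induction (venture `DiscreteObjects`, target L)

Cell `pub-namedobj`, seat `pub-namedobj-mahler-g28`. Framing: lottery ticket; floor = certified bounds/negative ranges.

F. Amoroso, R. Dvornicich, J. Number Theory 80 (2000), proof of Proposition 2 (the prime `2`; Lemma 3), assembled for ALL
conductors `m` by strong induction on `m` (degenerate case: twist + explicit descent `CyclotomicIntegerDescent` + fibre
transfer `CyclotomicIntegerTwistFibre`, as in `CyclotomicIntegerLehmerAll` for [cite: BombieriGubler2001, Theorem 4.4.9]):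
**for every `m ≥ 1`, every primitive `m`-th root of unity `ζ` and every `g ∈ ℤ[X]` with `g(ζ) ≠ 0` not a root of unity,
`2^{φ(m)} ≤ (∏_μ max(1,|g(μ)|))^6`** over the primitive `m`-th roots of unity (`cyclotomicInteger_prod_bound_two`).  The
Mahler-measure form `2^{deg α} ≤ M(α)^6` (`h(α) ≥ (log 2)/6`) is in `CyclotomicIntegerLehmerTwo`.  REPLICATION of the
published method with the trivial archimedean estimate; no new mathematics claimed.
-/

namespace Summit.Ventures.DiscreteObjects.Mahler

open Polynomial Finset

/-- **`2^{φ(m)} ≤ (∏_μ max(1,|g(μ)|))^6` for EVERY conductor `m`** and every `g ∈ ℤ[X]` with `g(ζ_m) ≠ 0` not a root of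
unity (Amoroso–Dvornicich's 2-adic argument with the trivial archimedean estimate; strong induction on `m`): `4 ∤ m`
directly (`CyclotomicIntegerTwoAdic`); `4 ∣ m`, `m = 2n`: with `σ : ζ ↦ -ζ` either `g(μ)² ≠ g(-μ)²` for all `μ` (bound
`H^4 ≤ H^6`) or a twist `ζ^a g(ζ)` is `σ`-invariant (`exists_twist_invariant`), equals `(contract₂ (X^a g))(ζ²)`
(`aeval_eq_aeval_contract_of_invariant`), and the induction hypothesis at `n` applies (`prod_primitiveRoots_pow_prime_eq`). -/
theorem cyclotomicInteger_prod_bound_two (m : ℕ) : 0 < m → ∀ (g : ℤ[X]) (ζ : ℂ), IsPrimitiveRoot ζ m →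
    aeval ζ g ≠ 0 → (∀ j : ℕ, 0 < j → aeval ζ g ^ j ≠ 1) →
    (2 : ℝ) ^ m.totient ≤ (∏ μ ∈ primitiveRoots m ℂ, max 1 ‖aeval μ g‖) ^ 6 := by
  induction m using Nat.strong_induction_on with
  | _ m ih =>
  intro hm0 g ζ hζ h0 hnu
  have hH1 : 1 ≤ ∏ μ ∈ primitiveRoots m ℂ, max 1 ‖aeval μ g‖ :=
    Finset.prod_induction _ (fun x : ℝ => 1 ≤ x) (fun _ _ ha hb => one_le_mul_of_one_le_of_one_le ha hb) le_rfl
      (fun _ _ => le_max_left _ _)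
  have hp2 : Nat.Prime 2 := Nat.prime_two
  by_cases h4 : 4 ∣ m
  · -- `m = 2 n` with `2 ∣ n`
    obtain ⟨q, hq⟩ := h4
    set n : ℕ := 2 * q with hndef
    have hmn : m = 2 * n := by rw [hq, hndef]; ring
    have h2n : 2 ∣ n := ⟨q, hndef⟩
    have hn : 0 < n := by
      rcases Nat.eq_zero_or_pos n with h | h
      · rw [h, mul_zero] at hmn; omega
      · exact h
    have hnm : n < m := by omega
    have hhalf : m / 2 = n := by rw [hmn, Nat.mul_div_cancel_left n (by norm_num : 0 < 2)]
    by_cases hdeg : ∃ μ ∈ primitiveRoots m ℂ, aeval μ g ^ 2 = aeval (μ ^ (1 + n)) g ^ 2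
    · -- degenerate case: twist, descend to `ζ²`, induct
      have hdeg' : aeval (ζ ^ (1 + n)) g ^ 2 = aeval ζ g ^ 2 := aeval_pow_pow_eq_of_exists hm0 g hζ hdeg
      obtain ⟨a, hinv⟩ := exists_twist_invariant hm0 hp2 hmn (k := 1 + n) (s := 1) (by ring) (by omega) g hζ h0 hdeg'
      have hdesc := aeval_eq_aeval_contract_of_invariant hm0 hp2 hmn h2n (t := 1) (by omega) (X ^ a * g) hζ
        (fun μ hμ => by rw [mul_one]; exact hinv μ hμ)
      set G : ℤ[X] := contract 2 (X ^ a * g) with hGdef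
      have hθ : IsPrimitiveRoot (ζ ^ 2) n := hζ.pow hm0 hmn
      have hζ0 : ζ ≠ 0 := hζ.ne_zero hm0.ne'
      have hval : aeval (ζ ^ 2) G = ζ ^ a * aeval ζ g := by rw [← hdesc, map_mul, map_pow, aeval_X]
      have hG0 : aeval (ζ ^ 2) G ≠ 0 := by
        rw [hval]; exact mul_ne_zero (pow_ne_zero _ hζ0) h0
      have hGnu : ∀ j : ℕ, 0 < j → aeval (ζ ^ 2) G ^ j ≠ 1 := by
        intro j hj hj1
        apply hnu (j * m) (Nat.mul_pos hj hm0)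
        have h1 : (ζ ^ a * aeval ζ g) ^ (j * m) = 1 := by rw [← hval, pow_mul, hj1, one_pow]
        rw [mul_pow, ← pow_mul, show a * (j * m) = m * (a * j) by ring, pow_mul, hζ.pow_eq_one, one_pow,
          one_mul] at h1
        exact h1
      have hIH := ih n hnm hn G (ζ ^ 2) hθ hG0 hGnu
      have hall : ∀ μ ∈ primitiveRoots m ℂ, aeval μ (X ^ a * g) = aeval (μ ^ 2) G := by
        intro μ hμ
        have hμ' := (mem_primitiveRoots hm0).1 hμ
        set Q : ℤ[X] := X ^ a * g - expand ℤ 2 G with hQ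
        have hQζ : aeval ζ Q = 0 := by rw [hQ, map_sub, expand_aeval, hdesc, sub_self]
        have hQμ := aeval_eq_zero_of_primitiveRoot hm0 hζ hQζ hμ'
        rwa [hQ, map_sub, expand_aeval, sub_eq_zero] at hQμ
      have hH : ∏ μ ∈ primitiveRoots m ℂ, max 1 ‖aeval μ g‖ =
          ∏ μ ∈ primitiveRoots m ℂ, max 1 ‖aeval (μ ^ 2) G‖ := by
        refine Finset.prod_congr rfl fun μ hμ => ?_
        rw [← hall μ hμ, map_mul, map_pow, aeval_X, norm_mul, norm_pow,
          ((mem_primitiveRoots hm0).1 hμ).norm'_eq_one hm0.ne', one_pow, one_mul]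
      have he : m.totient = 2 * n.totient := by rw [hmn, Nat.totient_mul_of_prime_of_dvd hp2 h2n]
      have hfib : ∏ μ ∈ primitiveRoots m ℂ, max 1 ‖aeval (μ ^ 2) G‖ =
          (∏ θ ∈ primitiveRoots n ℂ, max 1 ‖aeval θ G‖) ^ 2 :=
        prod_primitiveRoots_pow_prime_eq hm0 hp2 hmn hn he (fun z => max 1 ‖aeval z G‖)
      have hR : ((∏ θ ∈ primitiveRoots n ℂ, max 1 ‖aeval θ G‖) ^ 2) ^ 6 =
          ((∏ θ ∈ primitiveRoots n ℂ, max 1 ‖aeval θ G‖) ^ 6) ^ 2 := by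
        rw [← pow_mul, ← pow_mul, mul_comm]
      rw [hH, hfib, hR, he, mul_comm 2, pow_mul]
      exact pow_le_pow_left₀ (by positivity) hIH 2
    · -- nondegenerate case
      have hsep : ∀ μ ∈ primitiveRoots m ℂ, aeval μ g ^ 2 ≠ aeval (μ ^ (1 + m / 2)) g ^ 2 := by
        intro μ hμ heq
        rw [hhalf] at heq
        exact hdeg ⟨μ, hμ, heq⟩
      exact (two_pow_totient_le_of_four_dvd hm0 ⟨q, hq⟩ g hsep).trans (pow_le_pow_right₀ hH1 (by norm_num))
  · by_cases h2 : 2 ∣ m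
    · exact two_pow_totient_le_of_two_mod_four hm0 h2 h4 g hζ h0 hnu
    · exact two_pow_totient_le_of_odd hm0 h2 g hζ h0 hnu

end Summit.Ventures.DiscreteObjects.Mahler
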